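import Summits.Parity.GeneralizedHardyLittlewood.Theorems.FordMaynardSieveConst01651SieveConst01651LineDefs
import Literature.NumberTheory.Sieve.IwaniecAlmostPrimesMertens
import Summits.Parity.GeneralizedHardyLittlewood.Theorems.FordMaynardSieveConst01651SieveConst01651EdgeSet
import HarnessLib

/-!
# Route `FordMaynardSieveConst01651`, target `SieveConst01651` (stmt-Parity-19185): line `sieve_decomposition` re-homed — proofs, part 1 of 12 (file 2 of 13)

File 2 of 13 of the VERBATIM re-homing under `Theorems/` of the registered line skeleton
`Summits/Parity/GeneralizedHardyLittlewood/Cruxes/SieveConst01651/Lines/sieve_decomposition.lean` (v21, sha16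
`ada6d0765119a11e`; author seat `linewriter-parity-smallroutes-1`, g0 v1–v20 / g1 v21): Ford–Maynard, Theorem 7.3 (a) at
`P = (1/2, 0, ν)` with CLOSED support, cut along arXiv:2407.14368 §7.2 / §6.2, composed down to the route target
`Summit.Parity.GeneralizedHardyLittlewood.Theses.FordMaynardSieveConst01651.SieveConst01651`.  Namespace
`Summit.Parity.GeneralizedHardyLittlewood.FordMaynardSieveConst01651SieveDecomposition` (fresh; the `Cruxes` copy keeps its own), files of
≤ 400 lines chained by import; the three registered stubs are replaced by their landed proofs
(`…StubSignClauseFive` p834287, `…StubCertValuePos` p837763, `…TypeIIRegion` p833045), so the skeleton's composition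
`SieveConst01651_of_stubs` (last part) is sorry-free.  Mathematics, statements and comments are the linewriter's; this
re-homing (hand `leafhand-parity-fordmaynardsieveco-2` g4) only moved the definitions (`Eset`, `sliceTest`, `mainG1`, `vk`,
the `Signature.*` statement abbreviations, `Phi`, `innerI`, `jumpSet`, `gval`, `symmExt`, `idxProd`, `gam`) into the first
file, added docstrings where missing, and renamed two unused binders.
Declarations in this part: `signClauseFive_plain`, `coneCertClosed_of`, `mem_Eset`, `filter_prime_window`, `roughPart_one`, `smoothPart_one`, `Gwt_one`, `Gwt_prime_self`, `Hwt_prime`, `roughPart_dvd`, `length_mul_lt_one_of_rough`, `pvec_monotone`, `abs_Gwt_le`, `Hwt_abs_le`, `mem_Eset'`, `typeI_extract`, `sum_window_filter_dvd`, `card_cofactors_le`, `sum_sq_primes_le`.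

References: [FordMaynard2024PrimeSieves] K. Ford, J. Maynard, *On the theory of prime producing sieves*, arXiv:2407.14368,
Theorem 7.3 (a), Proposition 7.19, §6.2, §7.2, §8.2.
-/

noncomputable section

open Finset
open Literature.NumberTheory.Sieve Literature.NumberTheory.Sieve.FordMaynard Literature.Barriers.Parity.FordMaynard
open Summit.Parity.GeneralizedHardyLittlewood.FordMaynardSieveConst01651SieveConst01651
  (hfun Admissible hfun_apply hfun_of_ne pvec roughPart smoothPart Gwt Hwt window IsRough Nset Rset mem_window mem_Nset mem_Rset
   coneCert openSmall stub_hkPieces stub_coneCertClosed_of_residues' coneCert_signClause_five_of_generic)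

namespace Summit.Parity.GeneralizedHardyLittlewood.FordMaynardSieveConst01651SieveDecomposition

/-- The dim-5 sign clause in plain form from R1 (`…FiveGeneric.coneCert_signClause_five_of_generic`). -/
theorem signClauseFive_plain (h : Signature.stub_signClauseFive) :
    ∀ x : Fin 5 → ℝ, Monotone x → (∀ i, (1651 / 10000 : ℝ) < x i ∧ x i < 1 - 1651 / 10000) →
      ∑ i, x i = 1 → starSum coneCert 5 x ≤ 0 :=
  coneCert_signClause_five_of_generic h

/-- **v20's `stub_coneCertClosed` DISCHARGED modulo R1 + R2** (witness `coneCert`; = `…FiveGeneric.stub_coneCertClosed_of_generic_five`, unfolded as `…SignClauseFour.stub_coneCertClosed_of_residues'` ∘ `signClauseFive_plain`). -/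
theorem coneCertClosed_of (h₁ : Signature.stub_signClauseFive) (h₂ : Signature.stub_certValuePos) :
    Signature.stub_coneCertClosed :=
  stub_coneCertClosed_of_residues' (signClauseFive_plain h₁) h₂

/-- `mem_Eset` — lemma of the line skeleton `sieve_decomposition` (v21, seat `linewriter-parity-smallroutes-1`), re-homed verbatim. [folklore] -/
theorem mem_Eset {ν x : ℝ} {n : ℕ} : n ∈ Eset ν x ↔ n ∈ Nset ν x ∧ IsExc n := by
  unfold Eset; simp [mem_filter]

/-- `filter_prime_window` — lemma of the line skeleton `sieve_decomposition` (v21, seat `linewriter-parity-smallroutes-1`), re-homed verbatim. [folklore] -/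
theorem filter_prime_window (x : ℝ) : (window x).filter Nat.Prime = windowPrimes x := by
  ext n
  simp only [window, windowPrimes, mem_filter, mem_Icc, Nat.mem_primesLE]
  constructor
  · rintro ⟨⟨⟨-, h2⟩, h3⟩, hp⟩
    exact ⟨⟨h2, hp⟩, h3⟩
  · rintro ⟨⟨h2, hp⟩, h3⟩
    exact ⟨⟨⟨hp.one_lt.le, h2⟩, h3⟩, hp⟩

/-- `roughPart_one` — lemma of the line skeleton `sieve_decomposition` (v21, seat `linewriter-parity-smallroutes-1`), re-homed verbatim. [folklore] -/
theorem roughPart_one (y : ℝ) : roughPart y 1 = 1 := by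
  simp [roughPart]

/-- `smoothPart_rpow_one` — lemma of the line skeleton `sieve_decomposition` (v21, seat `linewriter-parity-smallroutes-1`), re-homed verbatim. [folklore] -/
theorem smoothPart_rpow_one (n : ℕ) (ν : ℝ) : smoothPart ((n : ℝ) ^ ν) 1 = 1 := by
  simp [smoothPart, roughPart_one]

/-- `Gwt_one` — lemma of the line skeleton `sieve_decomposition` (v21, seat `linewriter-parity-smallroutes-1`), re-homed verbatim. [folklore] -/
theorem Gwt_one {ν : ℝ} {g : VecFn} (hadm : Admissible ν g) {n : ℕ} (hn : 1 ≤ n) : Gwt g ν n 1 = 1 := by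
  obtain ⟨-, -, h0, -, -⟩ := hadm
  have hdim : ∀ (k : ℕ) (e : Fin k → ℝ), k = 0 → g k e = 1 := by
    intro k e hk; subst hk; exact h0 e
  have hcond : ((1 : ℕ) : ℝ) ≤ (n : ℝ) ^ (1 / 2 : ℝ) := by
    rw [Nat.cast_one]
    exact Real.one_le_rpow (by exact_mod_cast hn) (by norm_num)
  rw [Gwt, if_pos hcond, smoothPart_rpow_one, ArithmeticFunction.moebius_apply_one]
  rw [hdim _ _ (by rw [roughPart_one, Nat.primeFactorsList_one]; rfl)]
  simp

/-- `Gwt_prime_self` — lemma of the line skeleton `sieve_decomposition` (v21, seat `linewriter-parity-smallroutes-1`), re-homed verbatim. [folklore] -/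
theorem Gwt_prime_self {ν : ℝ} {g : VecFn} {p : ℕ} (hp : p.Prime) : Gwt g ν p p = 0 := by
  have h1 : (1 : ℝ) < (p : ℝ) := by exact_mod_cast hp.one_lt
  have hlt : (p : ℝ) ^ (1 / 2 : ℝ) < (p : ℝ) := by
    have := Real.rpow_lt_rpow_of_exponent_lt h1 (show (1 / 2 : ℝ) < 1 by norm_num)
    rwa [Real.rpow_one] at this
  rw [Gwt, if_neg (not_le.2 hlt)]

/-- `Hwt_prime` — lemma of the line skeleton `sieve_decomposition` (v21, seat `linewriter-parity-smallroutes-1`), re-homed verbatim. [folklore] -/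
theorem Hwt_prime {ν : ℝ} {g : VecFn} (hadm : Admissible ν g) {p : ℕ} (hp : p.Prime) : Hwt g ν p = 1 := by
  rw [Hwt, hp.divisors, sum_pair hp.one_lt.ne, Gwt_one hadm hp.one_lt.le, Gwt_prime_self hp, add_zero]

/-- `roughPart_dvd'` — lemma of the line skeleton `sieve_decomposition` (v21, seat `linewriter-parity-smallroutes-1`), re-homed verbatim. [folklore] -/
theorem roughPart_dvd' (y : ℝ) {d : ℕ} (hd' : 0 < d) : roughPart y d ∣ d := by
  have h := Nat.prod_factorization_pow_eq_self hd'.ne'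
  rw [Finsupp.prod, Nat.support_factorization] at h
  unfold roughPart
  conv_rhs => rw [← h]
  exact Finset.prod_dvd_prod_of_subset _ _ _ (filter_subset _ _)

/-- `length_mul_lt_one_of_rough` — lemma of the line skeleton `sieve_decomposition` (v21, seat `linewriter-parity-smallroutes-1`), re-homed verbatim. [folklore] -/
theorem length_mul_lt_one_of_rough {ν : ℝ} {n : ℕ} (hn : 2 ≤ n) (hr : IsRough ν n) :
    (n.primeFactorsList.length : ℝ) * ν < 1 := by
  set l := n.primeFactorsList with hl
  set t : ℕ := ⌊(n : ℝ) ^ ν⌋₊ + 1 with ht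
  have hn0 : n ≠ 0 := by omega
  have hnpos : (0 : ℝ) < (n : ℝ) ^ ν := by positivity
  have htle : ∀ p ∈ l, t ≤ p := by
    intro p hp
    have hp' : p ∈ n.primeFactors := Nat.mem_primeFactors_iff_mem_primeFactorsList.2 hp
    have hlt : (n : ℝ) ^ ν < (p : ℝ) := hr p hp'
    exact (Nat.floor_lt hnpos.le).2 hlt
  have hprod : t ^ l.length ≤ n := by
    have := List.pow_card_le_prod l t htle
    rwa [hl, Nat.prod_primeFactorsList hn0] at this
  have hlen : 1 ≤ l.length := by
    obtain ⟨p, hp, hpn⟩ := Nat.exists_prime_and_dvd (show n ≠ 1 by omega)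
    exact List.length_pos_of_mem ((Nat.mem_primeFactorsList hn0).2 ⟨hp, hpn⟩)
  have h1 : ((n : ℝ) ^ ν) ^ l.length < (t : ℝ) ^ l.length := by
    apply pow_lt_pow_left₀ _ hnpos.le (by omega)
    rw [ht]; push_cast; exact Nat.lt_floor_add_one _
  have h2 : ((t : ℝ)) ^ l.length ≤ (n : ℝ) := by exact_mod_cast hprod
  have hn1 : (1 : ℝ) < (n : ℝ) := by exact_mod_cast (show 1 < n by omega)
  have h3 : (n : ℝ) ^ ((l.length : ℝ) * ν) < (n : ℝ) ^ (1 : ℝ) := by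
    rw [mul_comm, Real.rpow_mul (by positivity), Real.rpow_natCast, Real.rpow_one]
    exact h1.trans_le h2
  exact (Real.rpow_lt_rpow_left_iff hn1).1 h3

/-- `pvec_monotone` — lemma of the line skeleton `sieve_decomposition` (v21, seat `linewriter-parity-smallroutes-1`), re-homed verbatim. [folklore] -/
theorem pvec_monotone {n : ℕ} (hn : 2 ≤ n) (d : ℕ) : Monotone (pvec n d) := by
  intro i j hij
  unfold pvec
  have hlog : 0 < Real.log n := Real.log_pos (by exact_mod_cast (show 1 < n by omega))
  apply div_le_div_of_nonneg_right _ hlog.le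
  have hi : 0 < d.primeFactorsList.get i := Nat.pos_of_mem_primeFactorsList (List.get_mem _ _)
  apply Real.log_le_log (by exact_mod_cast hi)
  exact_mod_cast Nat.primeFactorsList_sorted d hij

/-- `abs_Gwt_le` — lemma of the line skeleton `sieve_decomposition` (v21, seat `linewriter-parity-smallroutes-1`), re-homed verbatim. [folklore] -/
theorem abs_Gwt_le {ν : ℝ} {g : VecFn} {n d : ℕ} (hn : 2 ≤ n) {C : ℝ} (hC0 : 0 ≤ C)
    (hC : ∀ x : Fin (roughPart ((n : ℝ) ^ ν) d).primeFactorsList.length → ℝ, Monotone x → |g _ x| ≤ C) :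
    |Gwt g ν n d| ≤ C := by
  unfold Gwt
  split_ifs with h
  · rw [abs_mul]
    calc _ ≤ 1 * C := mul_le_mul (Iwaniec1978.abs_moebius_cast_le _) (hC _ (pvec_monotone hn _)) (abs_nonneg _) zero_le_one
      _ = C := one_mul C
  · simpa using hC0

/-- `Hwt_abs_le` — lemma of the line skeleton `sieve_decomposition` (v21, seat `linewriter-parity-smallroutes-1`), re-homed verbatim. [folklore] -/
theorem Hwt_abs_le {ν : ℝ} (hν : 0 < ν) {g : VecFn} (hpc : IsPiecewiseConstOnCone g) :
    ∃ M : ℝ, ∀ n : ℕ, 2 ≤ n → IsRough ν n → |Hwt g ν n| ≤ M := by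
  have hC : ∀ k, ∃ C : ℝ, ∀ x : Fin k → ℝ, Monotone x → |g k x| ≤ C := by
    intro k
    obtain ⟨m, P, c, -, hg⟩ := hpc k
    classical
    refine ⟨∑ j, |c j|, fun x hx => ?_⟩
    rw [hg x hx]
    refine (abs_sum_le_sum_abs _ _).trans (sum_le_sum fun j _ => ?_)
    split_ifs <;> simp
  choose C hC using hC
  set K₀ : ℕ := ⌊1 / ν⌋₊ with hK₀
  set Cmax : ℝ := ∑ k ∈ range (K₀ + 1), |C k| with hCmax
  have hCmax0 : 0 ≤ Cmax := sum_nonneg fun k _ => abs_nonneg _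
  have hCle : ∀ k, k ≤ K₀ → C k ≤ Cmax := fun k hk =>
    (le_abs_self _).trans
      (single_le_sum (f := fun k => |C k|) (fun k _ => abs_nonneg _) (mem_range.2 (Nat.lt_succ_of_le hk)))
  refine ⟨2 ^ K₀ * Cmax, fun n hn hr => ?_⟩
  have hn0 : n ≠ 0 := by omega
  have hlen := length_mul_lt_one_of_rough hn hr
  have hK : n.primeFactorsList.length ≤ K₀ := by
    apply Nat.le_floor
    rw [le_div_iff₀ hν]
    exact hlen.le
  have hG : ∀ d ∈ n.divisors, |Gwt g ν n d| ≤ Cmax := by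
    intro d hd
    have hd0 : d ≠ 0 := (Nat.pos_of_mem_divisors hd).ne'
    have hdvd : d ∣ n := Nat.dvd_of_mem_divisors hd
    have hlenr : (roughPart ((n : ℝ) ^ ν) d).primeFactorsList.length ≤ K₀ :=
      le_trans (Nat.primeFactorsList_sublist_of_dvd ((roughPart_dvd' _ (Nat.pos_of_ne_zero hd0)).trans hdvd) hn0).length_le hK
    exact abs_Gwt_le hn hCmax0 (fun x hx => (hC _ x hx).trans (hCle _ hlenr))
  calc |Hwt g ν n| ≤ ∑ d ∈ n.divisors, |Gwt g ν n d| := abs_sum_le_sum_abs _ _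
    _ ≤ ∑ d ∈ n.divisors, Cmax := sum_le_sum hG
    _ = n.divisors.card * Cmax := by rw [sum_const, nsmul_eq_mul]
    _ ≤ 2 ^ K₀ * Cmax := by
        apply mul_le_mul_of_nonneg_right _ hCmax0
        calc (n.divisors.card : ℝ) ≤ ((2 ^ n.primeFactorsList.length : ℕ) : ℝ) := by
              exact_mod_cast _root_.Summit.Parity.GeneralizedHardyLittlewood.FordMaynardSieveConst01651SieveConst01651.card_divisors_le_two_pow_length hn0
          _ ≤ ((2 ^ K₀ : ℕ) : ℝ) := by exact_mod_cast Nat.pow_le_pow_right two_pos hK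
          _ = 2 ^ K₀ := by push_cast; ring

/-- `mem_Eset'` — lemma of the line skeleton `sieve_decomposition` (v21, seat `linewriter-parity-smallroutes-1`), re-homed verbatim. [folklore] -/
theorem mem_Eset' {ν x : ℝ} {n : ℕ} :
    n ∈ Eset ν x ↔ (n ∈ window x ∧ (2 ≤ n ∧ ¬ n.Prime ∧ IsRough ν n)) ∧ IsExc n := by
  rw [mem_Eset, mem_Nset]

/-- `typeI_extract` — lemma of the line skeleton `sieve_decomposition` (v21, seat `linewriter-parity-smallroutes-1`), re-homed verbatim. [folklore] -/
theorem typeI_extract {w : ℕ → ℝ} {x B : ℝ} (hB : 0 ≤ B) (hT : TypeI w x (1 / 2) B) (I : ℕ → ℕ × ℕ)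
    {S : Finset ℕ} (hS : S ⊆ Icc 1 ⌊x ^ (1 / 2 : ℝ)⌋₊) :
    ∑ m ∈ S, |innerI w x I m| ≤ x / Real.log x ^ B := by
  have h : ∑ m ∈ Icc 1 ⌊x ^ (1 / 2 : ℝ)⌋₊, ((m.divisors.card : ℝ) ^ B) * |innerI w x I m|
      ≤ x / Real.log x ^ B := hT I
  refine le_trans ?_ h
  calc ∑ m ∈ S, |innerI w x I m| ≤ ∑ m ∈ S, ((m.divisors.card : ℝ) ^ B) * |innerI w x I m| := by
        refine sum_le_sum fun m hm => le_mul_of_one_le_left (abs_nonneg _) ?_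
        have hm1 : 1 ≤ m := (mem_Icc.1 (hS hm)).1
        have hcard : (1 : ℝ) ≤ (m.divisors.card : ℝ) := by
          have : 0 < m.divisors.card := Finset.card_pos.2 ⟨m, Nat.mem_divisors_self m (by omega)⟩
          exact_mod_cast this
        exact Real.one_le_rpow hcard hB
    _ ≤ ∑ m ∈ Icc 1 ⌊x ^ (1 / 2 : ℝ)⌋₊, ((m.divisors.card : ℝ) ^ B) * |innerI w x I m| :=
        sum_le_sum_of_subset_of_nonneg hS fun m _ _ =>
          mul_nonneg (Real.rpow_nonneg (Nat.cast_nonneg _) _) (abs_nonneg _)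

/-- `sum_window_filter_dvd` — lemma of the line skeleton `sieve_decomposition` (v21, seat `linewriter-parity-smallroutes-1`), re-homed verbatim. [folklore] -/
theorem sum_window_filter_dvd (f : ℕ → ℝ) {x : ℝ} (hx : 0 ≤ x) {m : ℕ} (hm : m ≠ 0) :
    ∑ n ∈ (window x).filter (fun n => m ∣ n), f n
      = ∑ k ∈ (Icc 1 ⌊x⌋₊).filter (fun k : ℕ => x / 2 < (m * k : ℝ) ∧ (m * k : ℝ) ≤ x), f (m * k) := by
  classical
  have hinj : Set.InjOn (fun k : ℕ => m * k)
      ↑((Icc 1 ⌊x⌋₊).filter (fun k : ℕ => x / 2 < (m * k : ℝ) ∧ (m * k : ℝ) ≤ x)) := by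
    intro a _ b _ hab
    exact Nat.eq_of_mul_eq_mul_left (Nat.pos_of_ne_zero hm) hab
  rw [← sum_image hinj]
  apply sum_congr _ (fun _ _ => rfl)
  ext n
  simp only [mem_filter, mem_image, mem_window, mem_Icc]
  constructor
  · rintro ⟨⟨⟨h1, h2⟩, h3⟩, k, rfl⟩
    have hk0 : k ≠ 0 := by rintro rfl; simp at h1
    refine ⟨k, ⟨⟨Nat.one_le_iff_ne_zero.2 hk0, le_trans (Nat.le_mul_of_pos_left k (Nat.pos_of_ne_zero hm)) h2⟩,
      ?_, ?_⟩, rfl⟩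
    · exact_mod_cast h3
    · have : ((m * k : ℕ) : ℝ) ≤ x := (Nat.cast_le.2 h2).trans (Nat.floor_le hx)
      exact_mod_cast this
  · rintro ⟨k, ⟨⟨h1, h2⟩, h3, h4⟩, rfl⟩
    refine ⟨⟨⟨Nat.one_le_iff_ne_zero.2 (mul_ne_zero hm (by omega)), Nat.le_floor (by exact_mod_cast h4)⟩,
      by exact_mod_cast h3⟩, Dvd.intro k rfl⟩

/-- `card_cofactors_le` — lemma of the line skeleton `sieve_decomposition` (v21, seat `linewriter-parity-smallroutes-1`), re-homed verbatim. [folklore] -/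
theorem card_cofactors_le {x : ℝ} (hx : 0 ≤ x) {m : ℕ} (hm : 0 < m) :
    (((Icc 1 ⌊x⌋₊).filter (fun k : ℕ => x / 2 < (m * k : ℝ) ∧ (m * k : ℝ) ≤ x)).card : ℝ)
      ≤ x / (2 * m) + 1 := by
  have hm' : (0 : ℝ) < m := by exact_mod_cast hm
  set A : ℕ := ⌊x / (2 * m)⌋₊ with hA
  set Bn : ℕ := ⌊x / m⌋₊ with hBn
  have hsub : (Icc 1 ⌊x⌋₊).filter (fun k : ℕ => x / 2 < (m * k : ℝ) ∧ (m * k : ℝ) ≤ x) ⊆ Ioc A Bn := by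
    intro k hk
    simp only [mem_filter, mem_Icc] at hk
    obtain ⟨-, h1, h2⟩ := hk
    rw [mem_Ioc]
    constructor
    · by_contra hle
      push Not at hle
      have hk' : (k : ℝ) ≤ x / (2 * m) := (Nat.cast_le.2 hle).trans (Nat.floor_le (by positivity))
      have : (m : ℝ) * k ≤ (m : ℝ) * (x / (2 * m)) := mul_le_mul_of_nonneg_left hk' hm'.le
      have h' : (m : ℝ) * (x / (2 * m)) = x / 2 := by field_simp
      linarith
    · apply Nat.le_floor
      rw [le_div_iff₀ hm']
      linarith [mul_comm (m : ℝ) k]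
  calc (((Icc 1 ⌊x⌋₊).filter (fun k : ℕ => x / 2 < (m * k : ℝ) ∧ (m * k : ℝ) ≤ x)).card : ℝ)
        ≤ ((Ioc A Bn).card : ℝ) := by exact_mod_cast card_le_card hsub
    _ = ((Bn - A : ℕ) : ℝ) := by rw [Nat.card_Ioc]
    _ ≤ x / (2 * m) + 1 := by
        rcases le_or_gt A Bn with h | h
        · rw [Nat.cast_sub h]
          have hB' : (Bn : ℝ) ≤ x / m := Nat.floor_le (by positivity)
          have hA' : x / (2 * m) < A + 1 := Nat.lt_floor_add_one _
          have : x / m = 2 * (x / (2 * m)) := by field_simp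
          linarith
        · rw [Nat.sub_eq_zero_of_le h.le]
          simp only [Nat.cast_zero]
          positivity

/-- `sum_sq_primes_le` — lemma of the line skeleton `sieve_decomposition` (v21, seat `linewriter-parity-smallroutes-1`), re-homed verbatim. [folklore] -/
theorem sum_sq_primes_le {x B : ℝ} (hx : 2 ≤ x) (hB : 0 ≤ B) {a : ℕ → ℝ} (ha : ∀ n, 0 ≤ a n)
    (hT : TypeI (fun n => a n - 1) x (1 / 2) B) {T : Finset ℕ} (hTw : T ⊆ window x)
    (hT2 : ∀ n ∈ T, ∃ p : ℕ, p.Prime ∧ n = p * p) :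
    ∑ n ∈ T, a n ≤ x / Real.log x ^ B + Real.sqrt x := by
  classical
  have hx0 : 0 < x := by linarith
  set w : ℕ → ℝ := fun n => a n - 1 with hw
  set S₂ : Finset ℕ := (Icc 1 ⌊x ^ (1 / 2 : ℝ)⌋₊).filter
    (fun p => p.Prime ∧ (x / 2 < (p * p : ℝ) ∧ (p * p : ℝ) ≤ x)) with hS₂
  have hsub : T ⊆ S₂.image (fun p => p * p) := by
    intro n hn
    obtain ⟨p, hp, rfl⟩ := hT2 n hn
    obtain ⟨⟨-, h2⟩, h3⟩ := mem_window.1 (hTw hn)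
    have h2' : ((p : ℝ) * p) ≤ x := by
      have : ((p * p : ℕ) : ℝ) ≤ x := (Nat.cast_le.2 h2).trans (Nat.floor_le hx0.le)
      exact_mod_cast this
    have h3' : x / 2 < (p : ℝ) * p := by exact_mod_cast h3
    refine mem_image.2 ⟨p, ?_, rfl⟩
    rw [hS₂, mem_filter, mem_Icc]
    refine ⟨⟨hp.one_lt.le, Nat.le_floor ?_⟩, hp, h3', h2'⟩
    rw [← Real.sqrt_eq_rpow]
    calc (p : ℝ) = Real.sqrt ((p : ℝ) * p) := (Real.sqrt_mul_self (Nat.cast_nonneg p)).symm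
      _ ≤ Real.sqrt x := Real.sqrt_le_sqrt h2'
  have hinj : Set.InjOn (fun p : ℕ => p * p) ↑S₂ := fun a _ b _ h => Nat.mul_self_inj.1 h
  set I₂ : ℕ → ℕ × ℕ := fun m => (m, m) with hI₂
  have hinner : ∀ p ∈ S₂, innerI w x I₂ p = a (p * p) - 1 := by
    intro p hp
    rw [hS₂, mem_filter] at hp
    obtain ⟨-, -, h3, h4⟩ := hp
    rw [innerI, hI₂]
    simp only [Icc_self, filter_singleton, h3, h4, and_self, if_true, sum_singleton, hw]
  have hS₂sub : S₂ ⊆ Icc 1 ⌊x ^ (1 / 2 : ℝ)⌋₊ := filter_subset _ _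
  have hI := typeI_extract hB hT I₂ hS₂sub
  have hcard : (S₂.card : ℝ) ≤ Real.sqrt x := by
    calc (S₂.card : ℝ) ≤ ((Icc 1 ⌊x ^ (1 / 2 : ℝ)⌋₊).card : ℝ) := by exact_mod_cast card_le_card hS₂sub
      _ = (⌊x ^ (1 / 2 : ℝ)⌋₊ : ℝ) := by simp
      _ ≤ x ^ (1 / 2 : ℝ) := Nat.floor_le (by positivity)
      _ = Real.sqrt x := (Real.sqrt_eq_rpow x).symm
  calc ∑ n ∈ T, a n ≤ ∑ n ∈ S₂.image (fun p => p * p), a n :=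
        sum_le_sum_of_subset_of_nonneg hsub fun n _ _ => ha n
    _ = ∑ p ∈ S₂, a (p * p) := sum_image hinj
    _ = ∑ p ∈ S₂, (innerI w x I₂ p + 1) := sum_congr rfl fun p hp => by rw [hinner p hp]; ring
    _ = ∑ p ∈ S₂, innerI w x I₂ p + S₂.card := by
        rw [sum_add_distrib, sum_const, nsmul_eq_mul, mul_one]
    _ ≤ ∑ p ∈ S₂, |innerI w x I₂ p| + S₂.card := by
        gcongr with p hp
        exact le_abs_self _
    _ ≤ x / Real.log x ^ B + Real.sqrt x := add_le_add hI hcard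

end Summit.Parity.GeneralizedHardyLittlewood.FordMaynardSieveConst01651SieveDecomposition

end
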